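import Summits.MatrixMultiplication.OmegaCensus.CyclicCosetOnsetRows
import Summits.MatrixMultiplication.OmegaCensus.STPPSmallPatternCyclicFatLifts

/-!
# ω-census, C8 (cyclic coset-onset law): coset rows from the THIN column — every cyclic `T2` host `n` gives a COSET `(2,2,2)^k` family in `ℤ/2n`

Cell `pub-omega`, ω construction census, seat pub-omega ENG2 (gen 33). HONEST FRAMING (verbatim): lottery ticket; floor =
certified bounds/negative ranges.  Bookkeeping companion of `CyclicCosetOnsetLaw.lean` (C8 typed), `CyclicCosetOnsetHosts.lean`,
`CyclicCosetOnsetRows.lean`; C8 stays a `def … : Prop`, neither proved nor asserted; nothing here bears on `ω`.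

The tree's coset lift `CosetOnset.hasCosetPow_two_mul` starts from a `(2,2,2)^k` family of `ℤ/n` (it shrinks `Aᵢ` to a point and takes
the full fibre along `ℤ/2n → ℤ/n`).  The shrinking step only needs `Aᵢ ≠ ∅`, so the SAME argument starts from the thin pattern
`(1,2,2)^k` — whose cyclic hosts are smaller (`c₆ = 60` vs. the `k = 6` cube hosts `≥ 112`):

* `hasCosetPow_two_mul_of_122pow` — **`(1,2,2)^k ⊆ ℤ/n` (`n ≥ 1`) ⇒ `ℤ/2n` hosts a COSET `(2,2,2)^k` family** (`HasCosetPow (2n) k`), hence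
  `2n ∈ evenCosetHosts k` and `sInf (evenHosts k) ≤ sInf (evenCosetHosts k) ≤ 2n`;
* ROWS (with the kernel `T2` hosts of ENG2 gen 31/32/33): `120, 124 ∈ evenCosetHosts 6` — **the `k = 6` interval of
  `CyclicCosetOnsetRows.onsets_six_mem_Icc` shrinks from `[44, 128]` to `[44, 120]`** for both onsets; new rows `k = 7 … 13`: both onsets in
  `[52, 152]`, `[60, 192]`, `[68, 244]`, `[76, 280]`, `[84, 328]`, `[92, 384]`, `[100, 464]` (upper ends `= 2 ×` the `T2` hosts `76, 96, 122, 140,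
  164, 192, 232`; lower ends the packing floor `8k − 4`);
* ALL `k`: `mem_evenCosetHosts_of_le_two_pow` — **`8·3^t ∈ evenCosetHosts k` for `k ≤ 2^t`** (the base-3 `T2` law at `m = 4·3^t`), so
  `sInf (evenCosetHosts k) ≤ 8·3^{⌈log₂ k⌉}` for every `k` (`sInf_evenCosetHosts_le_clog`; the tree's non-emptiness witness was `2·(416k²+416)^k`).

No lower-side (NONE) statement and no C8 instance is claimed.  References: H. Cohn, R. Kleinberg, B. Szegedy, C. Umans, FOCS 2005
(arXiv:math/0511460), Def. 5.1.  Seat pub-omega ENG2 (gen 33), 2026-08-28.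
-/

open Literature.Computability.AlgebraicComplexity Finset

namespace Summit.MatrixMultiplication.OmegaCensus

namespace CosetOnset

/-! ## 1. The coset lift from the thin pattern -/

/-- **The coset lift from `(1,2,2)^k`.**  If `ℤ/n` (`n ≥ 1`) hosts the size pattern `(1,2,2)^k`, then `ℤ/2n` hosts a `(2,2,2)^k` family in
which every triple contains a coset `{x, x + n}` of the subgroup of order two (in position `A`): take the full fibre of the point `Aᵢ`
under `ℤ/2n → ℤ/n` and lift `Bᵢ, Cᵢ` along a section (`isSTPP_of_image`; the proof of `hasCosetPow_two_mul` verbatim, which never used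
`|Aᵢ| = 2`). [cite: CohnKleinbergSzegedyUmans2005, Def. 5.1] -/
theorem hasCosetPow_two_mul_of_122pow {n k : ℕ} [NeZero n]
    (h : ∃ A B C : Fin k → Finset (ZMod n), IsSTPP A B C ∧ ∀ i, #(A i) = 1 ∧ #(B i) = 2 ∧ #(C i) = 2) :
    HasCosetPow (2 * n) k := by
  classical
  have hn0 : 0 < n := Nat.pos_of_ne_zero (NeZero.ne n)
  haveI : NeZero (2 * n) := ⟨by omega⟩
  have hdvd : n ∣ 2 * n := Dvd.intro_left 2 rfl
  set π : ZMod (2 * n) →+ ZMod n := (ZMod.castHom hdvd (ZMod n)).toAddMonoidHom with hπdef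
  have hπ : Function.Surjective π := ZMod.castHom_surjective hdvd
  set σ : ZMod n → ZMod (2 * n) := Function.surjInv hπ with hσdef
  have hσ : ∀ q, π (σ q) = q := Function.surjInv_eq hπ
  obtain ⟨A, B, C, hS, hc⟩ := h
  have hAne : ∀ i, (A i).Nonempty := fun i => card_pos.1 (by rw [(hc i).1]; norm_num)
  choose a ha using hAne
  have hnn : ((n : ℕ) : ZMod (2 * n)) ≠ 0 := by
    rw [Ne, ZMod.natCast_eq_zero_iff]
    intro hd
    have := Nat.le_of_dvd hn0 hd
    omega
  have hπn : π (n : ZMod (2 * n)) = 0 := by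
    simp [hπdef]
  have hfib_card : ∀ q : ZMod n, (univ.filter fun g => π g = q).card = 2 := by
    intro q
    have h := card_fiber_mul_card π hπ q
    rw [ZMod.card, ZMod.card] at h
    exact Nat.eq_of_mul_eq_mul_right hn0 h
  have hfib_eq : ∀ q : ZMod n, (univ.filter fun g => π g = q) = {σ q, σ q + (n : ZMod (2 * n))} := by
    intro q
    have hne : σ q ≠ σ q + (n : ZMod (2 * n)) := fun h => hnn (by linear_combination -h)
    symm
    apply eq_of_subset_of_card_le
    · intro g hg
      rw [mem_fiber_iff']
      rcases mem_insert.1 hg with rfl | hg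
      · exact hσ q
      · rw [mem_singleton.1 hg, map_add, hσ, hπn, add_zero]
    · rw [hfib_card, card_pair hne]
  refine ⟨fun i => univ.filter fun g => π g = a i, fun i => (B i).image σ, fun i => (C i).image σ, ?_, ?_, ?_⟩
  · apply isSTPP_of_image π
    · have hA : (fun i => (univ.filter fun g => π g = a i).image π) = fun i => {a i} :=
        funext fun i => image_fiber π hπ _
      have hB : (fun i => ((B i).image σ).image π) = B := funext fun i => image_image_section π hσ _
      have hC : (fun i => ((C i).image σ).image π) = C := funext fun i => image_image_section π hσ _
      rw [hA, hB, hC]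
      exact isSTPP_mono hS (fun i => singleton_subset_iff.2 (ha i)) (fun _ => Subset.rfl) fun _ => Subset.rfl
    · exact fun i => Or.inl ⟨injOn_image_section π hσ _, injOn_image_section π hσ _⟩
  · intro i
    exact ⟨hfib_card _, by rw [card_image_section π hσ, (hc i).2.1], by rw [card_image_section π hσ, (hc i).2.2]⟩
  · intro i
    refine Or.inl ⟨σ (a i), by beta_reduce; rw [mem_fiber_iff', hσ], ?_⟩
    beta_reduce
    rw [hfib_eq, Nat.mul_div_cancel_left n (by norm_num : 0 < 2)]

/-- A `T2` host `ℤ/n` (`n ≥ 1`) puts `2n` into `evenCosetHosts k`. -/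
theorem two_mul_mem_evenCosetHosts_of_122pow {n k : ℕ} [NeZero n]
    (h : ∃ A B C : Fin k → Finset (ZMod n), IsSTPP A B C ∧ ∀ i, #(A i) = 1 ∧ #(B i) = 2 ∧ #(C i) = 2) :
    2 * n ∈ evenCosetHosts k :=
  ⟨by have := NeZero.ne n; omega, ⟨n, two_mul n⟩, hasCosetPow_two_mul_of_122pow h⟩

/-- Both C8 onsets are at most twice any cyclic `T2` host. -/
theorem sInf_le_two_mul_of_122pow {n k : ℕ} [NeZero n]
    (h : ∃ A B C : Fin k → Finset (ZMod n), IsSTPP A B C ∧ ∀ i, #(A i) = 1 ∧ #(B i) = 2 ∧ #(C i) = 2) :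
    sInf (evenHosts k) ≤ 2 * n ∧ sInf (evenCosetHosts k) ≤ 2 * n :=
  sInf_le_of_mem_evenCosetHosts (two_mul_mem_evenCosetHosts_of_122pow h)

/-! ## 2. Rows `k = 6 … 13` -/

/-- **`120 ∈ evenCosetHosts 6`** (lift of `(1,2,2)⁶ ⊆ ℤ/60`) — a new cyclic host of the cube pattern below the old witness `128`. -/
theorem mem_evenCosetHosts_120_6 : 120 ∈ evenCosetHosts 6 :=
  two_mul_mem_evenCosetHosts_of_122pow (n := 60) (exists_isSTPP_122pow6_zmod_of_le60_of_not_mem 60 le_rfl (by decide))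

/-- `124 ∈ evenCosetHosts 6` (lift of `(1,2,2)⁶ ⊆ ℤ/62`). -/
theorem mem_evenCosetHosts_124_6 : 124 ∈ evenCosetHosts 6 :=
  two_mul_mem_evenCosetHosts_of_122pow (n := 62) (exists_isSTPP_122pow6_zmod_of_le60_of_not_mem 62 (by norm_num) (by decide))

/-- Every even `m ≥ 128` is in `evenCosetHosts 6` (lift of the `T2` ray from `64`). -/
theorem mem_evenCosetHosts_six_of_even {m : ℕ} (hm : 128 ≤ m) (he : Even m) : m ∈ evenCosetHosts 6 := by
  obtain ⟨n, rfl⟩ := he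
  rw [← two_mul] at hm ⊢
  haveI : NeZero n := ⟨by omega⟩
  exact two_mul_mem_evenCosetHosts_of_122pow (exists_isSTPP_122pow6_zmod_of_le64 n (by omega))

/-- **`k = 6` row, KERNEL interval (improved upper end):** both onsets lie in `[44, 120]` (was `[44, 128]`, `onsets_six_mem_Icc`). -/
theorem onsets_six_mem_Icc' : sInf (evenHosts 6) ∈ Set.Icc 44 120 ∧ sInf (evenCosetHosts 6) ∈ Set.Icc 44 120 :=
  ⟨⟨(onsets_six_mem_Icc.1).1, (sInf_le_of_mem_evenCosetHosts mem_evenCosetHosts_120_6).1⟩,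
    ⟨(onsets_six_mem_Icc.2).1, (sInf_le_of_mem_evenCosetHosts mem_evenCosetHosts_120_6).2⟩⟩

/-- `152 ∈ evenCosetHosts 7` (lift of `(1,2,2)⁷ ⊆ ℤ/76`). -/
theorem mem_evenCosetHosts_152_7 : 152 ∈ evenCosetHosts 7 :=
  two_mul_mem_evenCosetHosts_of_122pow (n := 76) (exists_isSTPP_122pow7_zmod_of_le76_of_not_mem' 76 le_rfl (by decide))

/-- **`k = 7` row, KERNEL interval:** both onsets lie in `[52, 152]`. -/
theorem onsets_seven_mem_Icc : sInf (evenHosts 7) ∈ Set.Icc 52 152 ∧ sInf (evenCosetHosts 7) ∈ Set.Icc 52 152 :=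
  ⟨⟨by have := (le_sInf_evenHosts 7).1; omega, (sInf_le_of_mem_evenCosetHosts mem_evenCosetHosts_152_7).1⟩,
    ⟨by have := (le_sInf_evenHosts 7).2; omega, (sInf_le_of_mem_evenCosetHosts mem_evenCosetHosts_152_7).2⟩⟩

/-- `192 ∈ evenCosetHosts 8` (lift of `(1,2,2)⁸ ⊆ ℤ/96`). -/
theorem mem_evenCosetHosts_192_8 : 192 ∈ evenCosetHosts 8 :=
  two_mul_mem_evenCosetHosts_of_122pow (n := 96) (exists_isSTPP_122pow8_zmod_of_le96_of_not_mem' 96 le_rfl (by decide))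

/-- **`k = 8` row, KERNEL interval:** both onsets lie in `[60, 192]`. -/
theorem onsets_eight_mem_Icc : sInf (evenHosts 8) ∈ Set.Icc 60 192 ∧ sInf (evenCosetHosts 8) ∈ Set.Icc 60 192 :=
  ⟨⟨by have := (le_sInf_evenHosts 8).1; omega, (sInf_le_of_mem_evenCosetHosts mem_evenCosetHosts_192_8).1⟩,
    ⟨by have := (le_sInf_evenHosts 8).2; omega, (sInf_le_of_mem_evenCosetHosts mem_evenCosetHosts_192_8).2⟩⟩

/-- `244 ∈ evenCosetHosts 9` (lift of `(1,2,2)⁹ ⊆ ℤ/122`). -/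
theorem mem_evenCosetHosts_244_9 : 244 ∈ evenCosetHosts 9 :=
  two_mul_mem_evenCosetHosts_of_122pow (n := 122) (exists_isSTPP_122pow9_zmod_of_even_or_le 122 le_rfl (Or.inl (by decide)))

/-- **`k = 9` row, KERNEL interval:** both onsets lie in `[68, 244]`. -/
theorem onsets_nine_mem_Icc : sInf (evenHosts 9) ∈ Set.Icc 68 244 ∧ sInf (evenCosetHosts 9) ∈ Set.Icc 68 244 :=
  ⟨⟨by have := (le_sInf_evenHosts 9).1; omega, (sInf_le_of_mem_evenCosetHosts mem_evenCosetHosts_244_9).1⟩,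
    ⟨by have := (le_sInf_evenHosts 9).2; omega, (sInf_le_of_mem_evenCosetHosts mem_evenCosetHosts_244_9).2⟩⟩

/-- `280 ∈ evenCosetHosts 10` (lift of `(1,2,2)¹⁰ ⊆ ℤ/140`). -/
theorem mem_evenCosetHosts_280_10 : 280 ∈ evenCosetHosts 10 :=
  two_mul_mem_evenCosetHosts_of_122pow (n := 140) (exists_isSTPP_122pow10_zmod_of 140 (Or.inl rfl))

/-- **`k = 10` row, KERNEL interval:** both onsets lie in `[76, 280]`. -/
theorem onsets_ten_mem_Icc : sInf (evenHosts 10) ∈ Set.Icc 76 280 ∧ sInf (evenCosetHosts 10) ∈ Set.Icc 76 280 :=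
  ⟨⟨by have := (le_sInf_evenHosts 10).1; omega, (sInf_le_of_mem_evenCosetHosts mem_evenCosetHosts_280_10).1⟩,
    ⟨by have := (le_sInf_evenHosts 10).2; omega, (sInf_le_of_mem_evenCosetHosts mem_evenCosetHosts_280_10).2⟩⟩

/-- `328 ∈ evenCosetHosts 11` (lift of `(1,2,2)¹¹ ⊆ ℤ/164`). -/
theorem mem_evenCosetHosts_328_11 : 328 ∈ evenCosetHosts 11 :=
  two_mul_mem_evenCosetHosts_of_122pow (n := 164) (exists_isSTPP_122pow11_zmod_of 164 (Or.inl rfl))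

/-- **`k = 11` row, KERNEL interval:** both onsets lie in `[84, 328]`. -/
theorem onsets_eleven_mem_Icc : sInf (evenHosts 11) ∈ Set.Icc 84 328 ∧ sInf (evenCosetHosts 11) ∈ Set.Icc 84 328 :=
  ⟨⟨by have := (le_sInf_evenHosts 11).1; omega, (sInf_le_of_mem_evenCosetHosts mem_evenCosetHosts_328_11).1⟩,
    ⟨by have := (le_sInf_evenHosts 11).2; omega, (sInf_le_of_mem_evenCosetHosts mem_evenCosetHosts_328_11).2⟩⟩

/-- `384 ∈ evenCosetHosts 12` (lift of `(1,2,2)¹² ⊆ ℤ/192`). -/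
theorem mem_evenCosetHosts_384_12 : 384 ∈ evenCosetHosts 12 :=
  two_mul_mem_evenCosetHosts_of_122pow (n := 192) (exists_isSTPP_122pow12_zmod_of 192 (Or.inl rfl))

/-- **`k = 12` row, KERNEL interval:** both onsets lie in `[92, 384]`. -/
theorem onsets_twelve_mem_Icc : sInf (evenHosts 12) ∈ Set.Icc 92 384 ∧ sInf (evenCosetHosts 12) ∈ Set.Icc 92 384 :=
  ⟨⟨by have := (le_sInf_evenHosts 12).1; omega, (sInf_le_of_mem_evenCosetHosts mem_evenCosetHosts_384_12).1⟩,
    ⟨by have := (le_sInf_evenHosts 12).2; omega, (sInf_le_of_mem_evenCosetHosts mem_evenCosetHosts_384_12).2⟩⟩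

/-- `464 ∈ evenCosetHosts 13` (lift of `(1,2,2)¹³ ⊆ ℤ/232`). -/
theorem mem_evenCosetHosts_464_13 : 464 ∈ evenCosetHosts 13 :=
  two_mul_mem_evenCosetHosts_of_122pow (n := 232) (exists_isSTPP_122pow13_zmod_of 232 (Or.inl rfl))

/-- **`k = 13` row, KERNEL interval:** both onsets lie in `[100, 464]`. -/
theorem onsets_thirteen_mem_Icc : sInf (evenHosts 13) ∈ Set.Icc 100 464 ∧ sInf (evenCosetHosts 13) ∈ Set.Icc 100 464 :=
  ⟨⟨by have := (le_sInf_evenHosts 13).1; omega, (sInf_le_of_mem_evenCosetHosts mem_evenCosetHosts_464_13).1⟩,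
    ⟨by have := (le_sInf_evenHosts 13).2; omega, (sInf_le_of_mem_evenCosetHosts mem_evenCosetHosts_464_13).2⟩⟩

/-! ## 3. All `k`: an explicit coset host from the base-3 `T2` law -/

/-- **`8·3^t ∈ evenCosetHosts k` for every `k ≤ 2^t`** (lift of `(1,2,2)^k ⊆ ℤ/(4·3^t)`, `exists_isSTPP_122pow_zmod_of_le_two_pow`). -/
theorem mem_evenCosetHosts_of_le_two_pow (t k : ℕ) (hk : k ≤ 2 ^ t) : 8 * 3 ^ t ∈ evenCosetHosts k := by
  haveI : NeZero (4 * 3 ^ t) := ⟨by positivity⟩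
  rw [show 8 * 3 ^ t = 2 * (4 * 3 ^ t) by ring]
  exact two_mul_mem_evenCosetHosts_of_122pow (exists_isSTPP_122pow_zmod_of_le_two_pow t k (4 * 3 ^ t) hk le_rfl)

/-- **Both C8 onsets are `≤ 8·3^{⌈log₂ k⌉}` for every `k`** (`< 24·k^{log₂ 3}`; the tree's non-emptiness witness was `2·(416k² + 416)^k`). -/
theorem sInf_evenCosetHosts_le_clog (k : ℕ) :
    sInf (evenHosts k) ≤ 8 * 3 ^ Nat.clog 2 k ∧ sInf (evenCosetHosts k) ≤ 8 * 3 ^ Nat.clog 2 k :=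
  sInf_le_of_mem_evenCosetHosts (mem_evenCosetHosts_of_le_two_pow (Nat.clog 2 k) k (Nat.le_pow_clog one_lt_two k))

end CosetOnset

end Summit.MatrixMultiplication.OmegaCensus
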